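import Mathlib
import HarnessLib
import Summits.MatrixMultiplication.MatrixMultiplication.Theorems.OutsiderSandwichToricCeilingPowMixedRules
import Summits.MatrixMultiplication.MatrixMultiplication.Theorems.OutsiderSandwichToricCeilingPowMixedStar

/-!
# OutsiderSandwich — mixed-basis toric ceiling `⟨3^N - 2⟩`, part 5: the CROSSED slice
(decomp-mm lens 4, gen 46, kernel K46-5; THESES-FREE, `ω`-free; helper toward `LaserTangency`,
stmt-32268 — the extremal subrank/packing cells of the literal host `kroneckerPow (cwTensor ℂ 2) N`)

LABEL.  TORIC · uniform in `N` · NEC-side instrument (a slice construction of the mixed machine;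
the theorem is assembled in a later part); the rates, the crux `h₁ = LaserTangency` and the route's
`closes` are untouched.

WHAT.  The CROSSED slice of `…PowSubTwoCrossed` (tight frame) ported to a product frame `frame κ`
with cw coordinates, at a PERMUTATION pivot `p`: `crossed_core` — `x₁ₚ = x₂ₚ = a`,
`{yₚ} = {zₚ} = {a + d, a + 2d}`; slot `a` carries the co-size-2 tail instance
`({x₁',x₂'}, {y_b', B₁}, {z_c', C₂})` (induction hypothesis `ih`, stated with the two-basis law
`lawκ`), slots `a + d`, `a + 2d` carry STARS (`…PowMixedStar.hasPM_star`, which needs at most one cw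
tail coordinate), and two auxiliary triples with tails from the two-basis flip rule
`…PowMixedRules.crκ`; the flags `y_b' ≠ B₁`, `z_c' ≠ C₂` are read at ONE permutation tail
coordinate `j₀`.  Every triple over the `A`-layer `a` has `B`-letter `a + d`, so the MIRROR
construction gives a second matching: `twoPMκ_crossedX`.
-/

set_option linter.dupNamespace false

namespace Summit.MatrixMultiplication.MatrixMultiplication.Theorems.OutsiderSandwichToricCeilingPowMixedCrossed

open Finset
open Summit.MatrixMultiplication.MatrixMultiplication.Theorems.OutsiderSandwichToricCeilingPowFibres
  (Word Tr3 slotB frame)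
open Summit.MatrixMultiplication.MatrixMultiplication.Theorems.OutsiderSandwichToricCeilingPowSubTwoGlue
open Summit.MatrixMultiplication.MatrixMultiplication.Theorems.OutsiderSandwichToricCeilingPowSubTwoRules
open Summit.MatrixMultiplication.MatrixMultiplication.Theorems.OutsiderSandwichToricCeilingPowMixedGlue
open Summit.MatrixMultiplication.MatrixMultiplication.Theorems.OutsiderSandwichToricCeilingPowMixedRules
open Summit.MatrixMultiplication.MatrixMultiplication.Theorems.OutsiderSandwichToricCeilingPowMixedStar
  (hasPM_star)

variable {m : ℕ}

/-- CROSSED CORE in a product frame, at a permutation pivot `p`: `x₁, x₂` in layer `a`; `y_b, z_b`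
in layer `a + d`; `y_c, z_c` in layer `a + 2d`.  Primary direction `d`: slot `a` carries the
co-size-2 tail instance `({x₁', x₂'}, {y_b', B₁}, {z_c', C₂})` (hypothesis `ih`), slots `a + d`,
`a + 2d` carry stars, and the two auxiliary triples `T° ∈ (a+2d, a+d, a)`, `T°° ∈ (a+d, a, a+2d)`
have tails given by the two-basis flip rule `crκ`.  Every triple of the matching with `A`-letter
`a` has `B`-letter `a + d`. -/
theorem crossed_core {p : Fin (m + 1)} {κ : Fin (m + 1) → Bool} (hp : κ p = false)
    (hκ₁ : ∀ i j, tailκ p κ i = true → tailκ p κ j = true → i = j)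
    (ih : ∀ x₁ x₂ y₁ y₂ z₁ z₂ : Word m, x₁ ≠ x₂ → y₁ ≠ y₂ → z₁ ≠ z₂ →
      (∀ j, lawκ (tailκ p κ j) (x₁ j) (x₂ j) (y₁ j) (y₂ j) (z₁ j) (z₂ j) = true) →
      ∃ P, isPMκ (tailκ p κ) P {x₁, x₂} {y₁, y₂} {z₁, z₂} = true)
    (j₀ : Fin m) (hj₀ : κ (p.succAbove j₀) = false) {a d : Fin 3} (hd : d ≠ 0)
    {x₁ x₂ yb yc zb zc : Word (m + 1)} (hx : x₁ ≠ x₂)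
    (hX1 : x₁ p = a) (hX2 : x₂ p = a) (hYb : yb p = a + d) (hYc : yc p = a + d + d)
    (hZb : zb p = a + d) (hZc : zc p = a + d + d)
    (hadm : ∀ j, lawκ (κ (p.succAbove j)) (x₁ (p.succAbove j)) (x₂ (p.succAbove j))
      (yb (p.succAbove j)) (yc (p.succAbove j)) (zb (p.succAbove j)) (zc (p.succAbove j)) = true) :
    ∃ P, isPMκ κ P {x₁, x₂} {yb, yc} {zb, zc} = true ∧
      ∀ t ∈ P, t.1 p = a → t.2.1 p = a + d := by
  obtain ⟨n₁, n₂, n₃⟩ := F3.lift_ne a d hd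
  have h3 : a + d + d + d = a := F3.add3 a d
  have H := fun j => crκ_spec (κ (p.succAbove j)) (x₁ (p.succAbove j)) (x₂ (p.succAbove j))
    (yb (p.succAbove j)) (yc (p.succAbove j)) (zb (p.succAbove j)) (zc (p.succAbove j)) (hadm j)
  -- tails of the auxiliary triples
  obtain ⟨A₁, hA₁⟩ : ∃ w : Word m, w = fun j => crκA₁ (κ (p.succAbove j)) (x₁ (p.succAbove j))
      (x₂ (p.succAbove j)) (yb (p.succAbove j)) (yc (p.succAbove j)) (zb (p.succAbove j))
      (zc (p.succAbove j)) := ⟨_, rfl⟩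
  obtain ⟨B₁, hB₁⟩ : ∃ w : Word m, w = fun j => crκB₁ (κ (p.succAbove j)) (x₁ (p.succAbove j))
      (x₂ (p.succAbove j)) (yb (p.succAbove j)) (yc (p.succAbove j)) (zb (p.succAbove j))
      (zc (p.succAbove j)) := ⟨_, rfl⟩
  obtain ⟨C₁, hC₁⟩ : ∃ w : Word m, w = fun j => crκC₁ (κ (p.succAbove j)) (x₁ (p.succAbove j))
      (x₂ (p.succAbove j)) (yb (p.succAbove j)) (yc (p.succAbove j)) (zb (p.succAbove j))
      (zc (p.succAbove j)) := ⟨_, rfl⟩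
  obtain ⟨A₂, hA₂⟩ : ∃ w : Word m, w = fun j => crκA₂ (κ (p.succAbove j)) (x₁ (p.succAbove j))
      (x₂ (p.succAbove j)) (yb (p.succAbove j)) (yc (p.succAbove j)) (zb (p.succAbove j))
      (zc (p.succAbove j)) := ⟨_, rfl⟩
  obtain ⟨B₂, hB₂⟩ : ∃ w : Word m, w = fun j => crκB₂ (κ (p.succAbove j)) (x₁ (p.succAbove j))
      (x₂ (p.succAbove j)) (yb (p.succAbove j)) (yc (p.succAbove j)) (zb (p.succAbove j))
      (zc (p.succAbove j)) := ⟨_, rfl⟩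
  obtain ⟨C₂, hC₂⟩ : ∃ w : Word m, w = fun j => crκC₂ (κ (p.succAbove j)) (x₁ (p.succAbove j))
      (x₂ (p.succAbove j)) (yb (p.succAbove j)) (yc (p.succAbove j)) (zb (p.succAbove j))
      (zc (p.succAbove j)) := ⟨_, rfl⟩
  have F1 : ((A₁, B₁, C₁) : Tr3 m) ∈ frame (tailκ p κ) := by
    rw [mem_frame]; intro j; rw [hA₁, hB₁, hC₁]; exact (H j).1
  have F2 : ((A₂, B₂, C₂) : Tr3 m) ∈ frame (tailκ p κ) := by
    rw [mem_frame]; intro j; rw [hA₂, hB₂, hC₂]; exact (H j).2.1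
  have F3s : ∀ j, A₂ j ≠ tl p yc j ∧ tl p yc j ≠ C₁ j ∧ A₂ j ≠ C₁ j := fun j => by
    rw [hA₂, hC₁]; exact (H j).2.2.1
  have F4 : ∀ j, A₁ j ≠ B₂ j ∧ B₂ j ≠ tl p zb j ∧ A₁ j ≠ tl p zb j := fun j => by
    rw [hA₁, hB₂]; exact (H j).2.2.2.1
  have F5 : ∀ j, lawκ (tailκ p κ j) (tl p x₁ j) (tl p x₂ j) (tl p yb j) (B₁ j) (tl p zc j) (C₂ j)
      = true := fun j => by rw [hB₁, hC₂]; exact (H j).2.2.2.2.1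
  -- the flags, from the permutation tail coordinate `j₀`
  have Fl := (H j₀).2.2.2.2.2 hj₀
  have F6 : tl p yb ≠ B₁ := fun e => Fl.1 (by
    have h := congrFun e j₀; rw [hB₁] at h; exact h.symm)
  have F7 : tl p zc ≠ C₂ := fun e => Fl.2 (by
    have h := congrFun e j₀; rw [hC₂] at h; exact h.symm)
  -- the three sub-matchings: induction in slot `a`, stars in the two other slots
  obtain ⟨Qa, hQa⟩ := ih (tl p x₁) (tl p x₂) (tl p yb) B₁ (tl p zc) C₂
    (tl_ne hx (hX1.trans hX2.symm)) F6 F7 F5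
  obtain ⟨Qb, hQb⟩ := hasPM_star m (tailκ p κ) hκ₁ A₂ (tl p yc) C₁ F3s
  obtain ⟨Qc, hQc⟩ := hasPM_star m (tailκ p κ) hκ₁ A₁ B₂ (tl p zb) F4
  -- the auxiliary triples
  obtain ⟨T₁, hT₁⟩ : ∃ T : Tr3 (m + 1), T = (ins p (a + d + d) A₁, ins p (a + d) B₁, ins p a C₁) :=
    ⟨_, rfl⟩
  obtain ⟨T₂, hT₂⟩ : ∃ T : Tr3 (m + 1), T = (ins p (a + d) A₂, ins p a B₂, ins p (a + d + d) C₂) :=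
    ⟨_, rfl⟩
  refine ⟨glue p d {T₁, T₂} fun a' => if a' = a then Qa else if a' = a + d then Qb else Qc, ?_, ?_⟩
  · refine isPMκ_glue hp hd ?_ ?_ ?_ ?_ ?_ ?_ ?_ ?_
    · intro t ht
      simp only [mem_insert, mem_singleton] at ht
      rcases ht with rfl | rfl
      · rw [hT₁]; exact (mk3_mem_frame hp).2 ⟨⟨n₂.symm, n₁.symm, n₃.symm⟩, F1⟩
      · rw [hT₂]; exact (mk3_mem_frame hp).2 ⟨⟨n₁.symm, n₃, n₂⟩, F2⟩
    · exact injOn_pair fun e => by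
        rw [hT₁, hT₂] at e; simp only [ins_inj] at e; exact absurd e.1 n₂.symm
    · exact injOn_pair fun e => by
        rw [hT₁, hT₂] at e; simp only [ins_inj] at e; exact absurd e.1 n₁.symm
    · exact injOn_pair fun e => by
        rw [hT₁, hT₂] at e; simp only [ins_inj] at e; exact absurd e.1 n₃
    · intro t ht
      simp only [mem_insert, mem_singleton] at ht
      rcases ht with rfl | rfl
      · rw [hT₁]; simp [ins_eq_iff, hX1, hX2, n₃.symm]
      · rw [hT₂]; simp [ins_eq_iff, hX1, hX2, n₁.symm]
    · intro t ht
      simp only [mem_insert, mem_singleton] at ht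
      rcases ht with rfl | rfl
      · rw [hT₁]; simp [ins_eq_iff, hYb, hYc, F6.symm, n₂]
      · rw [hT₂]; simp [ins_eq_iff, hYb, hYc, n₁, n₃]
    · intro t ht
      simp only [mem_insert, mem_singleton] at ht
      rcases ht with rfl | rfl
      · rw [hT₁]; simp [ins_eq_iff, hZb, hZc, n₁, n₃]
      · rw [hT₂]; simp [ins_eq_iff, hZb, hZc, F7.symm, n₂.symm]
    · intro a'
      rcases F3.cases3 a d a' hd with rfl | rfl | rfl
      · have e1 : layer p a' ({x₁, x₂} ∪ ({T₁, T₂} : Finset (Tr3 (m + 1))).image (fun t => t.1))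
            = {tl p x₁, tl p x₂} := by
          ext u; simp [hT₁, hT₂, ins_eq_iff, hX1, hX2, n₁, n₃]
        have e2 : layer p (a' + d) ({yb, yc} ∪ ({T₁, T₂} : Finset (Tr3 (m + 1))).image
            (fun t => t.2.1)) = {tl p yb, B₁} := by
          ext u; simp [hT₁, hT₂, ins_eq_iff, hYb, hYc, n₂, n₁.symm]; exact or_comm
        have e3 : layer p (a' + d + d) ({zb, zc} ∪ ({T₁, T₂} : Finset (Tr3 (m + 1))).image
            (fun t => t.2.2)) = {tl p zc, C₂} := by
          ext u; simp [hT₁, hT₂, ins_eq_iff, hZb, hZc, n₂.symm, n₃.symm]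
        rw [e1, e2, e3, if_pos rfl]
        exact hQa
      · have e1 : layer p (a + d) ({x₁, x₂} ∪ ({T₁, T₂} : Finset (Tr3 (m + 1))).image
            (fun t => t.1)) = {A₂} := by
          ext u; simp [hT₁, hT₂, ins_eq_iff, hX1, hX2, n₂, n₁.symm]
        have e2 : layer p (a + d + d) ({yb, yc} ∪ ({T₁, T₂} : Finset (Tr3 (m + 1))).image
            (fun t => t.2.1)) = {tl p yc} := by
          ext u; simp [hT₁, hT₂, ins_eq_iff, hYb, hYc, n₂.symm, n₃.symm]
        have e3 : layer p (a + d + d + d) ({zb, zc} ∪ ({T₁, T₂} : Finset (Tr3 (m + 1))).image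
            (fun t => t.2.2)) = {C₁} := by
          ext u; simp [hT₁, hT₂, ins_eq_iff, hZb, hZc, h3, n₁, n₃]
        rw [e1, e2, e3, if_neg n₁.symm, if_pos rfl]
        exact hQb
      · have e1 : layer p (a + d + d) ({x₁, x₂} ∪ ({T₁, T₂} : Finset (Tr3 (m + 1))).image
            (fun t => t.1)) = {A₁} := by
          ext u; simp [hT₁, hT₂, ins_eq_iff, hX1, hX2, n₂.symm, n₃.symm]
        have e2 : layer p (a + d + d + d) ({yb, yc} ∪ ({T₁, T₂} : Finset (Tr3 (m + 1))).image
            (fun t => t.2.1)) = {B₂} := by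
          ext u; simp [hT₁, hT₂, ins_eq_iff, hYb, hYc, h3, n₁, n₃]
        have e3 : layer p (a + d + d + d + d) ({zb, zc} ∪ ({T₁, T₂} : Finset (Tr3 (m + 1))).image
            (fun t => t.2.2)) = {tl p zb} := by
          ext u; simp [hT₁, hT₂, ins_eq_iff, hZb, hZc, h3, n₂, n₁.symm]
        rw [e1, e2, e3, if_neg n₃.symm, if_neg n₂.symm]
        exact hQc
  · intro t ht hta
    by_cases hA : t ∈ ({T₁, T₂} : Finset (Tr3 (m + 1)))
    · simp only [mem_insert, mem_singleton] at hA
      rcases hA with rfl | rfl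
      · rw [hT₁] at hta; simp [n₃.symm] at hta
      · rw [hT₂] at hta; simp [n₁.symm] at hta
    · rw [glue_dir ht hA, hta]

/-- **CROSSED SLICE, `x`-form, TWO MATCHINGS** in a product frame at a permutation pivot `p`
(`x₁ₚ = x₂ₚ`, `y₁ₚ ≠ y₂ₚ`): the core construction and its MIRROR (primary direction `-d`) differ
over the `A`-layer `a` in their `B`-letters. -/
theorem twoPMκ_crossedX {p : Fin (m + 1)} {κ : Fin (m + 1) → Bool} (hp : κ p = false)
    (hκ₁ : ∀ i j, tailκ p κ i = true → tailκ p κ j = true → i = j)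
    (ih : ∀ x₁ x₂ y₁ y₂ z₁ z₂ : Word m, x₁ ≠ x₂ → y₁ ≠ y₂ → z₁ ≠ z₂ →
      (∀ j, lawκ (tailκ p κ j) (x₁ j) (x₂ j) (y₁ j) (y₂ j) (z₁ j) (z₂ j) = true) →
      ∃ P, isPMκ (tailκ p κ) P {x₁, x₂} {y₁, y₂} {z₁, z₂} = true)
    (j₀ : Fin m) (hj₀ : κ (p.succAbove j₀) = false) {x₁ x₂ y₁ y₂ z₁ z₂ : Word (m + 1)}
    (hx : x₁ ≠ x₂) (hadm : ∀ i, lawκ (κ i) (x₁ i) (x₂ i) (y₁ i) (y₂ i) (z₁ i) (z₂ i) = true)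
    (hxp : x₁ p = x₂ p) (hyp : y₁ p ≠ y₂ p) :
    ∃ P₁ P₂, P₁ ≠ P₂ ∧ isPMκ κ P₁ {x₁, x₂} {y₁, y₂} {z₁, z₂} = true ∧
      isPMκ κ P₂ {x₁, x₂} {y₁, y₂} {z₁, z₂} = true := by
  have hm : 1 ≤ m := j₀.pos
  have hlaw : twice (x₁ p) (x₂ p) (y₁ p) (y₂ p) (z₁ p) (z₂ p) = true := by
    have h := hadm p; rw [hp] at h; exact h
  obtain ⟨⟨hxy₁, hxy₂⟩, hz⟩ := crossed_letters _ _ _ _ _ _ hlaw hxp hyp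
  -- the case `z₁ ~ y₁` (the other case by swapping `z₁, z₂`)
  have key : ∀ {z₁ z₂ : Word (m + 1)},
      (∀ i, lawκ (κ i) (x₁ i) (x₂ i) (y₁ i) (y₂ i) (z₁ i) (z₂ i) = true) → z₁ p = y₁ p →
      z₂ p = y₂ p →
      ∃ P₁ P₂, P₁ ≠ P₂ ∧ isPMκ κ P₁ {x₁, x₂} {y₁, y₂} {z₁, z₂} = true ∧
        isPMκ κ P₂ {x₁, x₂} {y₁, y₂} {z₁, z₂} = true := by
    intro z₁ z₂ hadm hz₁ hz₂
    obtain ⟨hd, hb, hc, -, -⟩ := F3.third (x₁ p) (y₁ p) (y₂ p) hxy₁ hyp hxy₂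
    obtain ⟨hd', hb', hc', -, -⟩ := F3.third (x₁ p) (y₂ p) (y₁ p) hxy₂ (Ne.symm hyp) hxy₁
    obtain ⟨P₁, h₁, dir₁⟩ := crossed_core hp hκ₁ ih j₀ hj₀ hd hx rfl hxp.symm hb.symm hc.symm
      (hz₁.trans hb.symm) (hz₂.trans hc.symm) (fun j => hadm _)
    obtain ⟨P₂, h₂, dir₂⟩ := crossed_core hp hκ₁ ih j₀ hj₀ hd' hx rfl hxp.symm hb'.symm hc'.symm
      (hz₂.trans hb'.symm) (hz₁.trans hc'.symm)
      (fun j => lawκ_swap_z _ _ _ _ _ _ _ (lawκ_swap_y _ _ _ _ _ _ _ (hadm _)))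
    rw [pair_comm y₂ y₁, pair_comm z₂ z₁] at h₂
    refine ⟨P₁, P₂, fun e => ?_, h₁, h₂⟩
    obtain ⟨u, hu₁, hu₂⟩ := exists_not_pair hm (tl p x₁) (tl p x₂)
    have hw : ins p (x₁ p) u ∈ P₁.image (fun t => t.1) := by
      rw [(isPMκ_iff.1 h₁).2.2.2.2.1, mem_sdiff]
      refine ⟨mem_univ _, ?_⟩
      simp [ins_eq_iff, hxp, hu₁, hu₂]
    rw [mem_image] at hw
    obtain ⟨t, ht, htw⟩ := hw
    have hta : t.1 p = x₁ p := by rw [htw, ins_apply_same]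
    have e₁ := dir₁ t ht hta
    have e₂ := dir₂ t (e ▸ ht) hta
    rw [hb] at e₁; rw [hb'] at e₂
    exact hyp (e₁.symm.trans e₂)
  rcases hz with ⟨hz₁, hz₂⟩ | ⟨hz₁, hz₂⟩
  · exact key hadm hz₁ hz₂
  · obtain ⟨P₁, P₂, hne, h₁, h₂⟩ :=
      key (fun i => lawκ_swap_z _ _ _ _ _ _ _ (hadm i)) hz₂ hz₁
    rw [pair_comm z₂ z₁] at h₁ h₂
    exact ⟨P₁, P₂, hne, h₁, h₂⟩

end Summit.MatrixMultiplication.MatrixMultiplication.Theorems.OutsiderSandwichToricCeilingPowMixedCrossed
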